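import Summits.BirchSwinnertonDyer.BirchSwinnertonDyer.Theorems.AdditiveKolyvaginRoadLocalDictionaries
import Summits.BirchSwinnertonDyer.BirchSwinnertonDyer.Theorems.KolyvaginRoadThreeZhangSupplyJumpStructures
import HarnessLib

/-!
# Route `AdditiveKolyvaginRoad`, crux `KolyvaginPrimitiveAdditive` (item stmt-BirchSwinnertonDyer-20132), stub LOC,
# towards (Supply) at a general prime `p` — the (J) ADAPTER: the binder `hjump` (global currency, toric level
# conditions) from its Poitou–Tate model form, and «isotropy + `#H¹ ≤ #L·#L` ⟹ Lagrangian»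
# (p-generic port of koly3b's `…ZhangSupplyJumpInclusion` + `…ZhangSupplyJumpAdapter` + §1 of `…JumpStructures`,
# `3 ↦ p`, ordinary ↦ TORIC, unipotent-admissible ↦ Bertolini–Darmon admissible (`AdmQ`), `GoodLevel` dropped)
# (cell `pub/bsd-wall`, lead prover `bsd-wall-akr-p1` g4; `--supports stmt-BirchSwinnertonDyer-20132`, helper)

WHY THIS FILE. The GLOBAL half of (Supply) (W. Zhang's Lemma 8.2 for the level structure) at a general prime `p` is the
jump `hjump` of the relaxed level structure `G(n, ℓ, T)` at a Kolyvagin prime `λ` (PORT MAP of akr-p1 g3). koly3b's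
parts XI–XII (`exists_forall_sub_zsmul_not_mem_ker_localization_of_lagrangian`) prove the jump for ANY `E[n]` in the
Poitou–Tate model; this file is the `p`-generic bookkeeping between that model and the additive route's global currency
(`selmerLocalKer`, `AdditiveKoly.toricLocalKer`, `AdditiveKoly.transverseLocalKerP`, `torsionLocalKer`):
* §1 `annRight_invWeilPairing_eq_of_isotropic_of_card_le` — at a finite place with `inv_v` injective, a local condition
  `L` which is isotropic for the local Weil cup product and has `#H¹(K_v, E[n]) ≤ #L · #L` is its own annihilator
  (the form in which the transverse and the TORIC Lagrangians are supplied: isotropy + a LOWER bound on `#L`);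
* §2 `selmerGroup_subset_relaxedGroupP` — `H¹_𝓖 ⊆ G(n, ℓ, T)` from per-place dictionaries (koly3b part XVI);
* §3 `hjump_of_selmerStructureP`, `hjump_of_lagrangianP` — the clause of `hjump` at `(n, ℓ, T)` from the model form
  (koly3b part XIV), over `ker loc_λ = torsionLocalKer_λ` (akr-p1 g3 `ker_localization_eq_torsionLocalKer_P`).

HONEST FRAMING: theorems only; 0 definitions, 0 named facts, 0 `sorry`; bookkeeping; closes nothing.

References: [cite: WZhang2014, §8.1, Lemma 8.2] [cite: McCallumLMS1991, Prop. 2.1 (p. 296)] [cite: MilneADT2006, Ch. I,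
Cor. 2.3, Cor. 3.4, Thm. 4.10] [cite: PoonenRains2012, Prop. 4.10] [cite: MazurRubin2004, Def. 2.1.1].
-/

-- single-conjunct summit: `Summit.BirchSwinnertonDyer.BirchSwinnertonDyer.…` repeats the name by design
set_option linter.dupNamespace false

noncomputable section

open scoped Classical NumberField
open Function NumberField IsDedekindDomain Field WeierstrassCurve
open Literature.NumberTheory.EllipticCurves Literature.NumberTheory.EllipticCurves.ModularForms
open Literature.NumberTheory.GaloisRepresentations Literature.NumberTheory.GaloisRepresentations.DiscreteGaloisModule
  Literature.NumberTheory.GaloisCohomology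
open Summit.BirchSwinnertonDyer.Rank1Residual.X11b.FiniteDuality
open Summit.BirchSwinnertonDyer.Rank1Residual.X11b.Relaxation
open Summit.BirchSwinnertonDyer.Rank1Residual.X11b
open Summit.BirchSwinnertonDyer.Rank1Residual.GaloisImage
open Summit.BirchSwinnertonDyer.Rank1Residual.X11b.Three.Koly.ZhangSupply

namespace Summit.BirchSwinnertonDyer.BirchSwinnertonDyer.Theorems.AdditiveKoly

-- Cup products need `LocallyCompactSpace Γ`; finiteness of `E[n]`: local instances (as in the tree's cup-product files).
attribute [local instance] absoluteGaloisGroup_compactSpace finite_geomTorsion_of_neZero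
  Literature.NumberTheory.EllipticCurves.finite_muCarrier

/-! ## §1 Isotropy + `#H¹ ≤ #L · #L` ⟹ Lagrangian -/

section Lagrangian

variable {K : Type} [Field K] [NumberField K] (E : WeierstrassCurve K) [E.IsElliptic] (n : ℕ) [NeZero n]
variable (e : E.geomTorsion n → E.geomTorsion n → AlgebraicClosure K)
  (hμ : ∀ S T, e S T ^ n = 1)
  (hadd₁ : ∀ S₁ S₂ T, e (S₁ + S₂) T = e S₁ T * e S₂ T)
  (hadd₂ : ∀ S T₁ T₂, e S (T₁ + T₂) = e S T₁ * e S T₂)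
  (hgal : ∀ (σ : absoluteGaloisGroup K) (S T : E.geomTorsion n), σ • e S T = e (σ • S) (σ • T))
  (hnondeg : ∀ T, (∀ S, e S T = 1) → T = 0)
  (inv : LocalInvariants K n)

include hnondeg in
/-- **Isotropy + `#H¹ ≤ #L·#L` ⟹ Lagrangian.** At a finite place `v` with `inv_v` injective, a local condition
`L ≤ H¹(K_v, E[n])` which is isotropic for the local Weil cup product `∪ₑ` and satisfies `#H¹(K_v, E[n]) ≤ #L · #L` is
its own right annihilator under `inv_v(· ∪ₑ ·)`: isotropy gives `L ≤ L^⊥`, local Tate duality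
(`natCard_annRight_mul`, right kernel trivial) gives `#L^⊥ · #L = #H¹ ≤ #L · #L`, so `#L^⊥ ≤ #L`. (koly3b's
`annRight_invWeilPairing_eq_of_isotropic_of_card` with the count weakened to a lower bound on `#L`.)
[cite: MilneADT2006, Ch. I, Cor. 2.3 and Cor. 3.4] [cite: PoonenRains2012, Prop. 4.10] -/
theorem annRight_invWeilPairing_eq_of_isotropic_of_card_le (v : HeightOneSpectrum (𝓞 K))
    (hinv : Injective (inv (Sum.inr v))) (L : AddSubgroup (galoisCohomology ((E.torsionGaloisModule n).toLocal
      (Sum.inr v)) 1))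
    (hiso : ∀ a ∈ L, ∀ b ∈ L, (weilContPairingLocal E n e hμ hadd₁ hadd₂ hgal (Sum.inr v)).cupProduct a b = 0)
    (hcard : Nat.card (galoisCohomology ((E.torsionGaloisModule n).toLocal (Sum.inr v)) 1) ≤
      Nat.card L * Nat.card L) :
    annRight (invWeilPairing E n e hμ hadd₁ hadd₂ hgal inv (Sum.inr v)) L = L := by
  haveI := KummerPT.finite_galoisCohomology_toLocal_inr E n v
  set b := invWeilPairing E n e hμ hadd₁ hadd₂ hgal inv (Sum.inr v) with hb
  have hA := KummerPT.nsmul_galoisCohomology_toLocal_eq_zero E n (Sum.inr v)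
  have hle : L ≤ annRight b L := fun y hy ↦ (mem_annRight_iff b L y).mpr fun x hx ↦ by
    rw [hb, invWeilPairing_apply, hiso x hx y hy]
    exact map_zero _
  have hmul : Nat.card (annRight b L) * Nat.card L =
      Nat.card (galoisCohomology ((E.torsionGaloisModule n).toLocal (Sum.inr v)) 1) :=
    natCard_annRight_mul hA b (KummerPT.invWeilPairing_flip_bijective E n e hμ hadd₁ hadd₂ hgal hnondeg inv v hinv) L
  have hLpos : 0 < Nat.card L := Nat.card_pos
  have hcard' : Nat.card (annRight b L) ≤ Nat.card L :=
    Nat.le_of_mul_le_mul_right (hmul.trans_le hcard) hLpos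
  exact (AddSubgroup.eq_of_le_of_card_ge hle hcard').symm

end Lagrangian

/-! ## §2 `H¹_𝓖 ⊆ G(n, ℓ, T)` from per-place dictionaries -/

section Inclusion

variable (W : WeierstrassCurve ℚ) (K : Type) [Field K] [NumberField K] (p : ℕ) [W.IsGloballyMinimal]
  (ι : K →+* ℂ)

/-- **`H¹_𝓖 ⊆ G(n, ℓ, T)` from per-place dictionaries** (the binder `hincl` of `hjump_of_lagrangianP`): if the
genuine conditions of a Selmer structure `𝓖` on `E[p]` lie inside the genuine Kummer condition at `∞` and at the finite
places off `λ ∪ plK(T) ∪ {v ∣ n}`, map into the TORIC kernel above the primes of `n` and into the TRANSVERSE kernel at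
the `plK ℓ'`, `ℓ' ∈ T`, then `H¹_𝓖 ⊆ G(n, ℓ, T)`. [cite: WZhang2014, §8.1] [cite: MazurRubin2004, Def. 2.1.1] -/
theorem selmerGroup_subset_relaxedGroupP
    (plK : {ℓ // Zhang2014.IsKolyvaginPrime (W.conductorNorm ℤ) W K p ℓ} → HeightOneSpectrum (𝓞 K))
    (n : Finset (AdmQ W K p)) (ℓ : {ℓ // Zhang2014.IsKolyvaginPrime (W.conductorNorm ℤ) W K p ℓ})
    (T : Finset {ℓ // Zhang2014.IsKolyvaginPrime (W.conductorNorm ℤ) W K p ℓ})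
    (𝓖 : SelmerStructure ((W.baseChange K).torsionGaloisModule ((p ^ 1 : ℕ) : ℤ)))
    (hGinf : ∀ w : InfinitePlace K,
      𝓖 (Sum.inl w) ≤ (W.baseChange K).kummerLocalConditionAt ((p ^ 1 : ℕ) : ℤ) w.Completion)
    (hGkum : ∀ v : HeightOneSpectrum (𝓞 K), v ≠ plK ℓ → (∀ ℓ' ∈ T, plK ℓ' ≠ v) →
      (∀ q ∈ n, ((q : ℕ) : 𝓞 K) ∉ v.asIdeal) →
      𝓖 (Sum.inr v) ≤ (W.baseChange K).kummerLocalConditionAt ((p ^ 1 : ℕ) : ℤ) (v.adicCompletion K))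
    (hGtor : ∀ v : HeightOneSpectrum (𝓞 K), v ≠ plK ℓ → (∀ ℓ' ∈ T, plK ℓ' ≠ v) → ∀ q ∈ n,
      ((q : ℕ) : 𝓞 K) ∈ v.asIdeal → ∀ x : Vp W K p,
      galoisCohomology.localization ((W.baseChange K).torsionGaloisModule ((p ^ 1 : ℕ) : ℤ)) (Sum.inr v) 1 x ∈
        𝓖 (Sum.inr v) → x ∈ toricLocalKer (W.baseChange K) (v.adicCompletion K) ((p ^ 1 : ℕ) : ℤ))
    (hGtr : ∀ ℓ' ∈ T, ∀ x : Vp W K p,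
      galoisCohomology.localization ((W.baseChange K).torsionGaloisModule ((p ^ 1 : ℕ) : ℤ)) (Sum.inr (plK ℓ')) 1 x ∈
        𝓖 (Sum.inr (plK ℓ')) → x ∈ transverseLocalKerP W K p ι ℓ' (plK ℓ')) :
    ∀ x ∈ 𝓖.selmerGroup,
      (∀ w : InfinitePlace K, x ∈ selmerLocalKer (W.baseChange K) w.Completion ((p ^ 1 : ℕ) : ℤ)) ∧
        (∀ v : HeightOneSpectrum (𝓞 K), v ≠ plK ℓ → (∀ ℓ' ∈ T, plK ℓ' ≠ v) →
          ((∀ q ∈ n, ((q : ℕ) : 𝓞 K) ∉ v.asIdeal) →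
            x ∈ selmerLocalKer (W.baseChange K) (v.adicCompletion K) ((p ^ 1 : ℕ) : ℤ)) ∧
          (∀ q ∈ n, ((q : ℕ) : 𝓞 K) ∈ v.asIdeal →
            x ∈ toricLocalKer (W.baseChange K) (v.adicCompletion K) ((p ^ 1 : ℕ) : ℤ))) ∧
        (∀ ℓ' ∈ T, x ∈ transverseLocalKerP W K p ι ℓ' (plK ℓ')) := by
  intro x hx
  rw [SelmerStructure.mem_selmerGroup_iff] at hx
  refine ⟨fun w ↦ ?_, fun v hv hvT ↦ ⟨fun hq ↦ ?_, fun q hq hqv ↦ ?_⟩, fun ℓ' hℓ' ↦ ?_⟩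
  · exact (mem_selmerLocalKer_iff_localization_mem_kummer_inf_P W K p w x).mpr (hGinf w (hx (Sum.inl w)))
  · exact (mem_selmerLocalKer_iff_localization_mem_kummer_P W K p v x).mpr (hGkum v hv hvT hq (hx (Sum.inr v)))
  · exact hGtor v hv hvT q hq hqv x (hx (Sum.inr v))
  · exact hGtr ℓ' hℓ' x (hx (Sum.inr (plK ℓ')))

end Inclusion

/-! ## §3 The clause of `hjump` at `(n, ℓ, T)` from the Poitou–Tate model -/

section Adapter

variable (W : WeierstrassCurve ℚ) (K : Type) [Field K] [NumberField K] (p : ℕ) [W.IsElliptic] [W.IsGloballyMinimal]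
  [Fact p.Prime] (ι : K →+* ℂ)

/-- **`hjump` at `(n, ℓ, T)` from the Poitou–Tate model.** If the Selmer group of a Selmer structure `𝓖` on `E[p]` lies
inside the relaxed group `G(n, ℓ, T)` (`hincl`) and for every `x₀` some class of `H¹_𝓖` is off the line `ℤ · loc_λ x₀`
modulo `ker loc_λ` (`hJ`), then the clause of the binder `hjump` holds at `(n, ℓ, T)`. [cite: WZhang2014, Lemma 8.2] -/
theorem hjump_of_selmerStructureP
    (plK : {ℓ // Zhang2014.IsKolyvaginPrime (W.conductorNorm ℤ) W K p ℓ} → HeightOneSpectrum (𝓞 K))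
    (n : Finset (AdmQ W K p)) (ℓ : {ℓ // Zhang2014.IsKolyvaginPrime (W.conductorNorm ℤ) W K p ℓ})
    (T : Finset {ℓ // Zhang2014.IsKolyvaginPrime (W.conductorNorm ℤ) W K p ℓ})
    (𝓖 : SelmerStructure ((W.baseChange K).torsionGaloisModule ((p ^ 1 : ℕ) : ℤ)))
    (hincl : ∀ x ∈ 𝓖.selmerGroup,
      (∀ w : InfinitePlace K, x ∈ selmerLocalKer (W.baseChange K) w.Completion ((p ^ 1 : ℕ) : ℤ)) ∧
        (∀ v : HeightOneSpectrum (𝓞 K), v ≠ plK ℓ → (∀ ℓ' ∈ T, plK ℓ' ≠ v) →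
          ((∀ q ∈ n, ((q : ℕ) : 𝓞 K) ∉ v.asIdeal) →
            x ∈ selmerLocalKer (W.baseChange K) (v.adicCompletion K) ((p ^ 1 : ℕ) : ℤ)) ∧
          (∀ q ∈ n, ((q : ℕ) : 𝓞 K) ∈ v.asIdeal →
            x ∈ toricLocalKer (W.baseChange K) (v.adicCompletion K) ((p ^ 1 : ℕ) : ℤ))) ∧
        (∀ ℓ' ∈ T, x ∈ transverseLocalKerP W K p ι ℓ' (plK ℓ')))
    (hJ : ∀ x₀ : Vp W K p, ∃ x : Vp W K p, x ∈ 𝓖.selmerGroup ∧ ∀ a : ℤ,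
      (x - a • x₀ : Vp W K p) ∉ (galoisCohomology.localization ((W.baseChange K).torsionGaloisModule
        ((p ^ 1 : ℕ) : ℤ)) (Sum.inr (plK ℓ)) 1).ker) :
    ∀ x₀ : Vp W K p, ∃ x : Vp W K p,
      ((∀ w : InfinitePlace K, x ∈ selmerLocalKer (W.baseChange K) w.Completion ((p ^ 1 : ℕ) : ℤ)) ∧
        (∀ v : HeightOneSpectrum (𝓞 K), v ≠ plK ℓ → (∀ ℓ' ∈ T, plK ℓ' ≠ v) →
          ((∀ q ∈ n, ((q : ℕ) : 𝓞 K) ∉ v.asIdeal) →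
            x ∈ selmerLocalKer (W.baseChange K) (v.adicCompletion K) ((p ^ 1 : ℕ) : ℤ)) ∧
          (∀ q ∈ n, ((q : ℕ) : 𝓞 K) ∈ v.asIdeal →
            x ∈ toricLocalKer (W.baseChange K) (v.adicCompletion K) ((p ^ 1 : ℕ) : ℤ))) ∧
        (∀ ℓ' ∈ T, x ∈ transverseLocalKerP W K p ι ℓ' (plK ℓ'))) ∧
      ∀ a : ℤ, x - a • x₀ ∉ (W.baseChange K).torsionLocalKer ((plK ℓ).adicCompletion K) ((p ^ 1 : ℕ) : ℤ) := by
  intro x₀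
  obtain ⟨x, hx, hxa⟩ := hJ x₀
  refine ⟨x, hincl x hx, fun a h ↦ hxa a ?_⟩
  rwa [ker_localization_eq_torsionLocalKer_P W K p (plK ℓ)]

/-- **`hjump` at `(n, ℓ, T)` END-TO-END from Poitou–Tate + Weil + LAGRANGIAN conditions** (koly3b part XII
`exists_forall_sub_zsmul_not_mem_ker_localization_of_lagrangian`, generic in the level, composed with
`hjump_of_selmerStructureP`). Inputs: a Poitou–Tate family `inv` at level `p`, a Weil pairing `e` on `E[p]`, a finite
set `T′` of finite places off which `p` is a unit and `E[p]` unramified, Selmer structures `𝓕 ≤ 𝓖` on `E[p]`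
unramified outside `S(T′)`, equal off `λ = plK ℓ ∈ T′`, strict ∕ relaxed at `λ`, with LAGRANGIAN common conditions
off `λ` (`hmax`), `H¹_𝓕` finite, `p² < #H¹(K_λ, E[p])`, and `H¹_𝓖 ⊆ G(n, ℓ, T)` (`hincl`). [cite: WZhang2014,
Lemma 8.2] [cite: McCallumLMS1991, Prop. 2.1 (p. 296)] [cite: MilneADT2006, Ch. I, Thm. 4.10] -/
theorem hjump_of_lagrangianP
    (plK : {ℓ // Zhang2014.IsKolyvaginPrime (W.conductorNorm ℤ) W K p ℓ} → HeightOneSpectrum (𝓞 K))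
    (n : Finset (AdmQ W K p)) (ℓ : {ℓ // Zhang2014.IsKolyvaginPrime (W.conductorNorm ℤ) W K p ℓ})
    (T : Finset {ℓ // Zhang2014.IsKolyvaginPrime (W.conductorNorm ℤ) W K p ℓ})
    (e : (W.baseChange K).geomTorsion (p ^ 1 : ℕ) → (W.baseChange K).geomTorsion (p ^ 1 : ℕ) → AlgebraicClosure K)
    (hμ : ∀ S T, e S T ^ (p ^ 1 : ℕ) = 1)
    (hadd₁ : ∀ S₁ S₂ T, e (S₁ + S₂) T = e S₁ T * e S₂ T)
    (hadd₂ : ∀ S T₁ T₂, e S (T₁ + T₂) = e S T₁ * e S T₂)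
    (hgal : ∀ (σ : Field.absoluteGaloisGroup K) (S T : (W.baseChange K).geomTorsion (p ^ 1 : ℕ)),
      σ • e S T = e (σ • S) (σ • T))
    (hnondeg : ∀ T, (∀ S, e S T = 1) → T = 0)
    (inv : LocalInvariants K (p ^ 1 : ℕ)) (hperf : inv.IsPerfect) (hsum : inv.SumLocalTermEqZero)
    (hcompl : inv.SelmerComplement)
    (T' : Finset (HeightOneSpectrum (𝓞 K)))
    (hS : ∀ v : HeightOneSpectrum (𝓞 K), v ∉ T' → (((p ^ 1 : ℕ) : ℕ) : 𝓞 K) ∉ v.asIdeal ∧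
      GaloisRep.IsUnramifiedAt v ((W.baseChange K).torsionGaloisModule (p ^ 1 : ℕ)))
    {𝓕 𝓖 : SelmerStructure ((W.baseChange K).torsionGaloisModule ((p ^ 1 : ℕ) : ℤ))}
    (h𝓕 : 𝓕.IsUnramifiedOutside (finSupport T')) (h𝓖 : 𝓖.IsUnramifiedOutside (finSupport T'))
    (w : T') (hwℓ : (w : HeightOneSpectrum (𝓞 K)) = plK ℓ)
    (heq : ∀ v : Place K, v ≠ Sum.inr w.1 → 𝓕 v = 𝓖 v)
    (hstrict : 𝓕 (Sum.inr w.1) = ⊥) (hrelax : 𝓖 (Sum.inr w.1) = ⊤) (hfin : Finite 𝓕.selmerGroup)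
    (hmax : ∀ v : Place K, v ≠ Sum.inr w.1 →
      annRight (invWeilPairing (W.baseChange K) (p ^ 1 : ℕ) e hμ hadd₁ hadd₂ hgal inv v) (𝓕 v) = 𝓕 v)
    (hw : (p ^ 1 : ℕ) ^ 2 <
      Nat.card (galoisCohomology (((W.baseChange K).torsionGaloisModule ((p ^ 1 : ℕ) : ℤ)).toLocal (Sum.inr w.1)) 1))
    (hincl : ∀ x ∈ 𝓖.selmerGroup,
      (∀ w : InfinitePlace K, x ∈ selmerLocalKer (W.baseChange K) w.Completion ((p ^ 1 : ℕ) : ℤ)) ∧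
        (∀ v : HeightOneSpectrum (𝓞 K), v ≠ plK ℓ → (∀ ℓ' ∈ T, plK ℓ' ≠ v) →
          ((∀ q ∈ n, ((q : ℕ) : 𝓞 K) ∉ v.asIdeal) →
            x ∈ selmerLocalKer (W.baseChange K) (v.adicCompletion K) ((p ^ 1 : ℕ) : ℤ)) ∧
          (∀ q ∈ n, ((q : ℕ) : 𝓞 K) ∈ v.asIdeal →
            x ∈ toricLocalKer (W.baseChange K) (v.adicCompletion K) ((p ^ 1 : ℕ) : ℤ))) ∧
        (∀ ℓ' ∈ T, x ∈ transverseLocalKerP W K p ι ℓ' (plK ℓ'))) :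
    ∀ x₀ : Vp W K p, ∃ x : Vp W K p,
      ((∀ w : InfinitePlace K, x ∈ selmerLocalKer (W.baseChange K) w.Completion ((p ^ 1 : ℕ) : ℤ)) ∧
        (∀ v : HeightOneSpectrum (𝓞 K), v ≠ plK ℓ → (∀ ℓ' ∈ T, plK ℓ' ≠ v) →
          ((∀ q ∈ n, ((q : ℕ) : 𝓞 K) ∉ v.asIdeal) →
            x ∈ selmerLocalKer (W.baseChange K) (v.adicCompletion K) ((p ^ 1 : ℕ) : ℤ)) ∧
          (∀ q ∈ n, ((q : ℕ) : 𝓞 K) ∈ v.asIdeal →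
            x ∈ toricLocalKer (W.baseChange K) (v.adicCompletion K) ((p ^ 1 : ℕ) : ℤ))) ∧
        (∀ ℓ' ∈ T, x ∈ transverseLocalKerP W K p ι ℓ' (plK ℓ'))) ∧
      ∀ a : ℤ, x - a • x₀ ∉ (W.baseChange K).torsionLocalKer ((plK ℓ).adicCompletion K) ((p ^ 1 : ℕ) : ℤ) := by
  have hp : p.Prime := Fact.out
  haveI : NeZero (p ^ 1 : ℕ) := ⟨pow_ne_zero 1 hp.ne_zero⟩
  refine hjump_of_selmerStructureP W K p ι plK n ℓ T 𝓖 hincl fun x₀ ↦ ?_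
  obtain ⟨x, hx, hxa⟩ := exists_forall_sub_zsmul_not_mem_ker_localization_of_lagrangian (W.baseChange K) (p ^ 1 : ℕ)
    e hμ hadd₁ hadd₂ hgal hnondeg inv hperf hsum hcompl T' hS h𝓕 h𝓖 w heq hstrict hrelax hfin hmax hw x₀
  refine ⟨x, hx, fun a ↦ ?_⟩
  rw [← hwℓ]
  exact hxa a

end Adapter

end Summit.BirchSwinnertonDyer.BirchSwinnertonDyer.Theorems.AdditiveKoly

end
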